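import Summits.Ventures.CertifiedManyBodySolver.Downfold.EmeryShapeWindowClosure
import Summits.Ventures.CertifiedManyBodySolver.Downfold.EmeryFermiScalePointsYBCO7planeK26VirtualCorners
import HarnessLib

/-!
# THE ONE-BAND FERMI-SURFACE SHAPE `t′/t` OF THE WHOLE TYPED 3BE BOX `emeryBoxYBCO7planeY6K26Src (EmeryBoxesKSlicesE)` FROM TWO VIRTUAL CORNERS (two-ray rule + window closure, §B.86;
# router/EMERY-SHAPE-CORNERS.tsv)

Venture CertifiedManyBodySolver, cell `pub/hubbard-downfold` (stage S1; INFLATION-RULES-3to1-B §B.86 (i)), seat hubbard-downfold-mod-4 (technique B, g35); namespace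
`Summit.Ventures.CertifiedManyBodySolver.Downfold.Emery`. Everything PROVED (0 sorry). WHAT THIS IS NOT: a statement about YBa₂Cu₃O₇ plane Cu(2) ((K) #66-type source box) — the typed box is SCREENING-GRADE (its file's
grade line); `U = 0` one-body kinematics of the σ model (object E = the EXACT `t–t′` shape of the σ Fermi surface, `EmeryFermiSurfaceShape`); no interaction, no `t″`.

For EVERY one-body row `(Δ, t_pd, t_pp, t_pp′) ∈ [7/4, 47/20] × [117/100, 139/100] × [61/100, 73/100] × [3/20, 3/20]` eV and the fillings below, the one-band `t′/t` of the σ-model Fermi surface AT THAT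
ROW'S OWN FERMI ENERGY lies in the window of the table (device: `EmeryShapeTwoRayRule` + `EmeryShapeWindowClosure`, exactly as `EmeryBoxesLa214ShapeCorners`; virtual corners
`V_lo = (1.75, 1.17, 0.73, 0.1795)`, `V_hi = (2.35, 1.39, 0.61, 0.1253)`, t_pp′ outside the typed range by the factor b₂/b₁ = 1.197 — the explicit 3 → 1 inflation, zero iff the box is pure or of fixed
t_pp′/t_pp ratio; certificates `EmeryFermiScalePointsYBCO7planeK26VirtualCorners`).

| filling | certified window for t′/t over the WHOLE box | V_lo ε_F bracket | V_hi ε_F bracket | lower closure | EMERY-FS-WINDOWS (g19 sub-box device) | object-E row of record [float] |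
|---|---|---|---|---|---|---|
| n_H = 1.16 (ν = 21/50) | **[-0.3225, -0.2483]** | [1.5287, 1.5387] eV | [1.7372, 1.7472] eV | antitone (dd ≥ 0.150 on the window): L = fsRatio(V_lo; e₂) | [-0.3169,-0.2527] (n_H [1.16,1.165]) | [-0.63,-0.44] |

Sources: three-band model [HybertsenSchluterChristensen1989, Eq. (1)]; [AndersenEtAl1995, §6]; box rows as cited in the typed object's file.
-/

noncomputable section

namespace Summit.Ventures.CertifiedManyBodySolver.Downfold.Emery

open Real Set

/-- **n_H = 1.16 (ν = 21/50): for every row of the box the one-band Fermi-surface `t′/t` (object E, at the row's own Fermi energy) lies in `[-0.3225, -0.2483]`.** Lower closure: antitone; upper: monotone. [folklore] -/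
theorem yBCO7planeK26Box_fsRatio_nH116 {Δ a b c : ℝ} (hΔ : Δ ∈ Icc ((7 : ℝ) / 4) ((47 : ℝ) / 20)) (ha : a ∈ Icc ((117 : ℝ) / 100) ((139 : ℝ) / 100)) (hb : b ∈ Icc ((61 : ℝ) / 100) ((73 : ℝ) / 100)) (hc : c ∈ Icc ((3 : ℝ) / 20) ((3 : ℝ) / 20)) :
    fsRatio Δ a b c (fermiEnergyOf Δ a b c ((21 : ℝ) / 50)) ∈ Icc ((-129 : ℝ) / 400) ((-2483 : ℝ) / 10000) := by
  have hV : ((3 : ℝ) / 20) * ((73 : ℝ) / 100) / ((61 : ℝ) / 100) = ((219 : ℝ) / 1220) := by norm_num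
  have hW : ((3 : ℝ) / 20) * ((61 : ℝ) / 100) / ((73 : ℝ) / 100) = ((183 : ℝ) / 1460) := by norm_num
  have hVlo := (fermiEnergyOf_of_pointBracketCheck virtPt_YBCO7planeK26Vlo_nH116_br (by norm_num) (by norm_num) (by norm_num) (ν := (21/50 : ℝ)) (by push_cast; exact ⟨le_rfl, le_rfl⟩)).2
  have hVhi := (fermiEnergyOf_of_pointBracketCheck virtPt_YBCO7planeK26Vhi_nH116_br (by norm_num) (by norm_num) (by norm_num) (ν := (21/50 : ℝ)) (by push_cast; exact ⟨le_rfl, le_rfl⟩)).2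
  have hAlo := (fermiEnergyOf_of_pointBracketCheck virtPt_YBCO7planeK26Alo_nH116_br (by norm_num) (by norm_num) (by norm_num) (ν := (21/50 : ℝ)) (by push_cast; exact ⟨le_rfl, le_rfl⟩)).2
  have hTop := (fermiEnergyOf_of_pointBracketCheck virtPt_YBCO7planeK26H_nH116_br (by norm_num) (by norm_num) (by norm_num) (ν := (21/50 : ℝ)) (by push_cast; exact ⟨le_rfl, le_rfl⟩)).2
  push_cast at hVlo hVhi hAlo hTop
  norm_num at hVlo hVhi hAlo hTop
  refine fsRatio_fermiEnergyOf_mem_Icc_windowClosure (Δ₁ := ((7 : ℝ) / 4)) (Δ₂ := ((47 : ℝ) / 20)) (a₁ := ((117 : ℝ) / 100)) (a₂ := ((139 : ℝ) / 100)) (b₁ := ((61 : ℝ) / 100))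
    (b₂ := ((73 : ℝ) / 100)) (c₁ := ((3 : ℝ) / 20)) (c₂ := ((3 : ℝ) / 20)) (e₁ := ((15287 : ℝ) / 10000)) (e₂ := ((15659 : ℝ) / 10000)) (e₃ := 0) (e₄ := ((1092 : ℝ) / 625)) (by norm_num) (by norm_num) (by norm_num) (by norm_num)
    (by norm_num) hΔ ha hb hc (by norm_num) (by norm_num) ?_ ?_ ?_ (by norm_num) ?_ ?_ ?_ (by norm_num) ?_
  · -- regime at the box's Fermi-energy high corner: c₂ b₂ ε_F(Δ₁, a₂, b₂, c₁) ≤ a₁² b₁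
    nlinarith [hTop.2]
  · rw [hV]; exact hVlo.1
  · exact hAlo.2
  · intro ε hε
    rw [hV]
    have hanti := (fsRatio_mem_Icc_on_window_of_dopingDisc_nonneg (Δ := ((7 : ℝ) / 4)) (a := ((117 : ℝ) / 100)) (b := ((73 : ℝ) / 100)) (c := ((219 : ℝ) / 1220))
      (p := ((15287 : ℝ) / 10000)) (q := ((15659 : ℝ) / 10000)) (by norm_num) (by norm_num) (by norm_num) (by norm_num) (by norm_num) (by norm_num) (by norm_num)
      (by norm_num [dopingDisc]) hε).1
    refine le_trans ?_ hanti
    norm_num [fsRatio, fsD, fsN]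
  · exact (fermiEnergyOf_pos (by norm_num) (by norm_num) (by norm_num) (by norm_num) (by norm_num) (by norm_num)).le
  · rw [hW]; exact hVhi.2
  · intro ε hε
    rw [hW]
    have hmono := (fsRatio_mem_Icc_on_window_of_dopingDisc_nonpos (Δ := ((47 : ℝ) / 20)) (a := ((139 : ℝ) / 100)) (b := ((61 : ℝ) / 100)) (c := ((183 : ℝ) / 1460))
      (p := 0) (q := ((1092 : ℝ) / 625)) (by norm_num) (by norm_num) (by norm_num) (by norm_num) (by norm_num) (by norm_num) (by norm_num)
      (by norm_num [dopingDisc]) hε).2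
    refine le_trans hmono ?_
    norm_num [fsRatio, fsD, fsN]

end Summit.Ventures.CertifiedManyBodySolver.Downfold.Emery
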